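import Summits.ResolutionOfSingularities.ResolutionOfSingularities.Theorems.SchonResolves.Negative.AntecedentNeedsReembedding

/-!
# `SchonResolves` (crux stmt-ResolutionOfSingularities-17234, route `TropicalLinks`), negative-side support:
# the `∀`-strengthening of the antecedent `SchonAt p 1` over guarded re-embeddings is FALSE
# (refuter cdisprove seat, gen 2; this file does NOT refute the crux)

Companion of `Negative/AntecedentNeedsReembedding.lean`, which exhibits — for `U = 𝔾_m` (`N = 1`,
`I = ⊥`) over ANY field — a guard-passing re-embedding `(m, G) = (1, (x₁−1)²)` violating the schön
clause of the crux's antecedent. Here the remaining binder of `SchonAt p 1` is discharged: the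
dimension hypothesis `ringKrullDim (k[ℤ¹] ⧸ ⊥) = 1` (`ringKrullDim_torus_rank_one`, through
`k[ℤ¹] ⧸ ⊥ ≃ k[ℤ¹] ≃ k[T;T⁻¹]`, a localization of the PID `k[X]`, hence of dimension `≤ 1`, and not a
field because `T − 1` is a nonzero non-unit). Consequence, kernel-checked for every prime `p`
(`k = AlgebraicClosure (ZMod p)`):

* `schonAt_one_forall_reembedding_false` — the statement obtained from the antecedent's `d = 1`
  instance `SchonAt p 1` by strengthening its `∃ (m, G), (∀ j, G j ∉ I) ∧ clause` to
  `∀ (m, G), (∀ j, G j ∉ I) → clause` (clause = the route's text verbatim) is FALSE. So any proof of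
  the crux that consumed the antecedent only through properties shared by ALL guarded re-embeddings
  of `U` (e.g. "`U[G⁻¹]` is a regular principal open") would prove the `∀`-version's consequences
  and cannot exist: the specific `G` delivered by the antecedent must enter the toric construction
  (it fixes the torus `𝔾_m^(N+m)`, the tropical fan and the initial degenerations). For the planner:
  `SchonAt` sits strictly between "every principal open re-embeds regularly" (trivial) and the
  `∀`-version (false).
-/

noncomputable section

-- single-problem summit: the doubled namespace component `ResolutionOfSingularities` is forced
set_option linter.dupNamespace false

namespace Summit.ResolutionOfSingularities.ResolutionOfSingularities.Theorems.SchonResolves.Negative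

open Polynomial LaurentPolynomial

/-- `T − 1 ∈ k[T;T⁻¹]` is not a unit: it dies under evaluation at `T = 1`. [folklore] -/
theorem laurent_not_isUnit_T_sub_one (k : Type) [Field k] :
    ¬ IsUnit (T 1 - 1 : LaurentPolynomial k) := by
  intro h
  have h2 := h.map (LaurentPolynomial.eval₂ (RingHom.id k) (1 : kˣ))
  rw [map_sub, map_one, LaurentPolynomial.eval₂_T] at h2
  simp at h2

/-- `T − 1 ≠ 0` in `k[T;T⁻¹]`. [folklore] -/
theorem laurent_T_sub_one_ne_zero (k : Type) [Field k] : (T 1 - 1 : LaurentPolynomial k) ≠ 0 := by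
  intro h
  rw [sub_eq_zero, ← T_zero] at h
  change (AddMonoidAlgebra.single (1 : ℤ) (1 : k) : LaurentPolynomial k) = AddMonoidAlgebra.single 0 1 at h
  rw [AddMonoidAlgebra.single_left_inj one_ne_zero] at h
  exact one_ne_zero h

/-- **`dim k[T;T⁻¹] = 1`** for a field `k`: `≤ 1` as a localization of the PID `k[X]`
(`Ring.DimensionLEOne.localization`), `≥ 1` because a zero-dimensional domain is a field and
`T − 1` is a nonzero non-unit. [folklore] -/
theorem ringKrullDim_laurentPolynomial (k : Type) [Field k] : ringKrullDim (LaurentPolynomial k) = 1 := by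
  haveI : Ring.DimensionLEOne (LaurentPolynomial k) :=
    Ring.DimensionLEOne.localization (LaurentPolynomial k) (M := Submonoid.powers (X : k[X]))
      (powers_le_nonZeroDivisors_of_noZeroDivisors Polynomial.X_ne_zero)
  have hle : ringKrullDim (LaurentPolynomial k) ≤ 1 := by
    rw [← Nat.cast_one, ← Ring.krullDimLE_iff]; infer_instance
  apply eq_of_le_of_not_lt hle
  intro hlt
  have h0 : ringKrullDim (LaurentPolynomial k) ≤ 0 := Order.le_of_lt_succ hlt
  rw [← Nat.cast_zero, ← Ring.krullDimLE_iff] at h0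
  have hF : IsField (LaurentPolynomial k) := Ring.KrullDimLE.isField_of_isDomain
  obtain ⟨b, hb⟩ := hF.mul_inv_cancel (laurent_T_sub_one_ne_zero k)
  exact laurent_not_isUnit_T_sub_one k ⟨⟨_, b, hb, by rwa [mul_comm] at hb⟩, rfl⟩

/-- **The dimension binder of `SchonAt p 1` at the witness**: `ringKrullDim (k[ℤ¹] ⧸ ⊥) = 1`
(`k[Fin 1 → ℤ] ⧸ ⊥ ≃ k[Fin 1 → ℤ] ≃ k[ℤ] = k[T;T⁻¹]`). [folklore] -/
theorem ringKrullDim_torus_rank_one (k : Type) [Field k] :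
    ringKrullDim (AddMonoidAlgebra k (Fin 1 → ℤ) ⧸ (⊥ : Ideal (AddMonoidAlgebra k (Fin 1 → ℤ)))) =
      ((1 : ℕ) : WithBot ℕ∞) := by
  rw [ringKrullDim_eq_of_ringEquiv (RingEquiv.quotientBot _),
    ringKrullDim_eq_of_ringEquiv
      (AddMonoidAlgebra.domCongr k k (AddEquiv.funUnique (Fin 1) ℤ)).toRingEquiv]
  rw [Nat.cast_one]
  exact ringKrullDim_laurentPolynomial k

section ForallFalse

open scoped Classical

/-- **The `∀`-strengthening of the antecedent's `d = 1` instance is false, for every prime `p`.**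
Displayed: `SchonAt p 1` (the route's inlined lambda at `d = 1`) with `∃ (m) (G), (∀ j, G j ∉ I) ∧ …`
replaced by `∀ (m) (G), (∀ j, G j ∉ I) → …` (the schön clause verbatim). Witness:
`k = AlgebraicClosure (ZMod p)`, `N = 1`, `I = ⊥` (prime, `ringKrullDim = 1`), and the guarded
re-embedding of `Negative/AntecedentNeedsReembedding.lean`. [folklore] -/
theorem schonAt_one_forall_reembedding_false (p : ℕ) [Fact p.Prime] :
    ¬ ∀ (k : Type) [Field k] [CharP k p] [IsAlgClosed k] (N : ℕ) (I : Ideal (AddMonoidAlgebra k (Fin N → ℤ))), I.IsPrime → ringKrullDim (AddMonoidAlgebra k (Fin N → ℤ) ⧸ I) = ((1 : ℕ) : WithBot ℕ∞) → ∀ (m : ℕ) (G : Fin m → AddMonoidAlgebra k (Fin N → ℤ)), (∀ j, G j ∉ I) → ∀ (w : Fin (N + m) → ℤ) (P : Ideal (AddMonoidAlgebra k (Fin (N + m) → ℤ) ⧸ Ideal.span ((fun f : AddMonoidAlgebra k (Fin (N + m) → ℤ) => AddMonoidAlgebra.ofCoeff (f.coeff.filter fun v => ∀ u ∈ f.coeff.support,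 ∑ i, w i * v i ≤ ∑ i, w i * u i)) '' (↑(Ideal.span ((fun f : AddMonoidAlgebra k (Fin N → ℤ) => (AddMonoidAlgebra.ofCoeff (f.coeff.mapDomain fun v => Fin.append v (0 : Fin m → ℤ)) : AddMonoidAlgebra k (Fin (N + m) → ℤ))) '' (↑I : Set (AddMonoidAlgebra k (Fin N → ℤ))) ∪ Set.range (fun j : Fin m => AddMonoidAlgebra.single (Fin.append (0 : Fin N → ℤ) (Pi.single j (1 : ℤ))) (1 : k) - AddMonoidAlgebra.ofCoeff ((G j).coeff.mapDomain fun v => Fin.append v (0 : Fin m → ℤ))))) : Set (AddMonoidAlgebra k (Fin (N + m) → ℤ)))))) [P.IsPrime], IsRegularLocalRing (Localization.AtPrime P) := by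
  intro h
  obtain ⟨m, G, hG, hnot⟩ := exists_guarded_reembedding_not_schonClause (AlgebraicClosure (ZMod p))
  exact hnot (h (AlgebraicClosure (ZMod p)) 1 ⊥ Ideal.isPrime_bot (ringKrullDim_torus_rank_one _) m G hG)

end ForallFalse

end Summit.ResolutionOfSingularities.ResolutionOfSingularities.Theorems.SchonResolves.Negative

end
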